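import Mathlib.LinearAlgebra.Matrix.Rank
import Mathlib.FieldTheory.RatFunc.AsPolynomial
import Literature.LinearAlgebra.Matrix.RankMinors
import Literature.Barriers.ValiantsHypothesis.AlgebraicNaturalProofs
import Literature.Computability.AlgebraicComplexity.MatrixMultiplicationExponent
import Literature.Computability.AlgebraicComplexity.SchoenhageTau
import Literature.Computability.Complexity.Counting
import Literature.Computability.Complexity.Promise
import Literature.Computability.Complexity.CNF
import HarnessLib

/-!
# Bläser–Ikenmeyer–Jindal–Lysikov 2018, §1–§5 and App. B: (border) completion rank, its
NP-hardness, and the conditional algebraic-natural-proofs barrier for border completion rank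

Typed literature (val-lit cell, typer t23; D-0064 one file per source section-group; this file =
§1.1 Def. 1, §2 Defs. 8–9, §3 (Thm. 3, Obs. 10, Lemma 11, Obs. 12, Lemmas 13–14, Obs. 15,
Lemma 16, Thm. 4 and its strengthening, Obs. 17), §4 (Thm. 18, Prop. 19), §5 (Thm. 20,
Lemmas 21–22, Thm. 23), App. B; the sibling `BIJL18PermanentZero.lean` types §6–§7 and App. A).
Source: M. Bläser, C. Ikenmeyer, G. Jindal, V. Lysikov, *Generalized matrix completion and
algebraic natural proofs*, STOC 2018, 1193–1206 = ECCC TR18-064 [BlaserIkenmeyerJindalLysikov2018].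
Locators: `ECCC p.N` = page of the ECCC report (held as `paper:url-fc2542cbbad3`, materialised by
`lit read https://eccc.weizmann.ac.il/report/2018/064/download/`); `s2 pNNNN:Lnn` = chunk/line of
the held STOC text `paper:doi-10-1145-3188745-3188832` (its displayed formulas are lost in
extraction; statement numbering is identical in both versions). HONEST FRAMING: typed literature;
`VP ≠ VNP` is NOT proved and nothing here is progress on it.

**What the paper does (§1–§5).** For a tensor `t = (A₀, A₁, …, A_m)` of `n × n` matrices
(equivalently the matrix `A₀ + x₁A₁ + ⋯ + x_mA_m` of affine linear forms) the COMPLETION RANK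
`CR(t)` is `min_λ rk(A₀ + Σ λᵢ Aᵢ)` (Def. 8) and the BORDER COMPLETION RANK `\underline{CR}(t)` is
its degeneration version over `K(ε)` (Def. 9). Both `CR ≤ r` (Lemma 11) and `\underline{CR} ≤ r`
(Lemma 14, Thm. 3) are NP-hard via Max-2-SAT clause gadgets `[[1-ℓ₁, 1],[0, 1-ℓ₂]]`; hence
(Thm. 4) the `{−1,0,1}`-tensors `T_φ` do not all have `poly(n)`-size constant-free algebraic
natural proofs of `\underline{CR}(T_φ) > r` unless `coNP ⊆ ∃BPP`. §4: `R(t) = CR(t) + m` for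
linearly independent slices with `rk Aᵢ = 1` (Thm. 18, Derksen), `\underline{R} ≤ \underline{CR} + m`
(Prop. 19); §5: completion rank and tensor rank are NP-hard to approximate within `1 + γ`
(Thms. 20, 23, via a `9 × 9` rank-one clause gadget, Lemmas 21–22).

**Design / rendering notes (read by referees).**
* Slices are indexed by an arbitrary finite type `κ` (`A : κ → Matrix ι ι K`) plus the constant
  slice `A₀`; the paper's `(A₀, …, A_m) ∈ K^{n×n×(m+1)}` is `ι = Fin n`, `κ = Fin m`.
* `f = a + O(ε)` for `f ∈ K(ε)` (ECCC p. 8: Laurent expansions agree below `ε¹`) is rendered as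
  "`f` is regular at `0` with value `a`": reduced denominator non-vanishing at `0` and
  `RatFunc.eval _ 0 f = a` (`IsApproxOf`).
* Def. 9 prints the slice condition `Ãᵢ ∈ K(ε)^{n×n}_{rk(Aᵢ)}`, `0 ≤ i ≤ m`, i.e. INCLUDING the
  constant slice; the motivating sentence (ECCC p. 8, "we take the closure in
  `K^{n×n} × K^{n×n}_{r₁} × ⋯ × K^{n×n}_{r_m}`") and Obs. 17 constrain only the slices `i ≥ 1`.
  We type Def. 9 LITERALLY (`borderCompletionRank`); every statement below holds verbatim under
  either reading (Lemma 13/14 use the constraint for `i ≥ 1` only; exact tensors satisfy both).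
* NP-hardness (Thm. 3, Lemma 11, Thms. 20, 23) is stated with the tree's Karp hardness
  `IsNPHard` / `PromiseProblem.IsNPHard` for explicitly Boolean-encoded instances
  `(n, m, entries ∈ ℤ^{(m+1)n²} row-major, r)` read over the field `K` (`tensorOfList`); the
  reductions produce `{−1,0,1}`-tensors, so this sub-problem carries the printed hardness.
  "NP-hard to approximate within `1 + γ`" = NP-hardness of the gap promise problem
  (yes: `CR ≤ r`; no: `CR > (1+γ) r`).
* `∃BPP` is the tree's `polyExists BPP` (`∃·BPP`; the paper: "`∃BPP` is known to be a subset of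
  `MA` … can be replaced by `MA` in the statements of all our results", ECCC p. 2).
* "algebraic `poly(n)`-natural proof" (ECCC p. 11, items 1–3: `p(t) ≠ 0`, `p` vanishes on
  `{s : \underline{CR}(s) ≤ r}`, `p` has a CONSTANT-FREE circuit of size `poly(n)`) is
  `IsBorderCRProof` with an explicit circuit witness (`HasSignConstants`), never via the junk-prone
  `sInf` size measures; `poly(n)` = `n ^ c + c` for some `c`, "for infinitely many `n`" =
  `∀ n₀, ∃ n ≥ n₀`.
* Thm. 4 is stated for an INFINITE field (`[Infinite K]`): the printed proof tests `p ∘ g ≡ 0` by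
  PIT, which characterises vanishing on the `K`-points of the variety only over infinite `K`
  (§2: "One can think of `K = ℂ`"); this is weaker than the unqualified printed sentence.
* Border tensor rank in Prop. 19 is the tree's algebraic `algBorderRank` (Bläser 2013 Def. 6.1 =
  BCS97 §20.6, the definition the paper refers to: "as was done for the tensor rank, see [BCS97]").
* Cited, not restated: Def. 1 first clause = `IsNaturalProof` (FSV Def. 1), Def. 2 =
  `IsSuccinctHittingSet`, the dichotomy "exactly one of … natural proof / succinct hitting set"
  = `exists_isNaturalProof_iff` (FSV Thm. 4), tensor rank `tensorRank`, border rank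
  `algBorderRank`, classes `coNP`, `BPP`, `polyExists`, `IsNPHard`, `CNF`/`Literal`.
* ERRATUM (val-lit 2026-08-26): the printed Lemma 22 (2) (`εs`-gap) is FALSE as worded for the
  `T_φ` of a general 3-CNF — `not_BIJL2018_lemma22` (sibling `BIJL18TPhiCompletionRankProofs.lean`);
  the typed `BIJL2018_lemma22` keeps the printed wording and is marked REFUTED AS WORDED (do not
  consume); the exact, gap-free reduction the printed ingredients do prove is `BIJL2018_lemma22_safe`
  (PROVED, `BIJL2018_lemma22_safe_holds`, sibling `BIJL18TPhiSafeProofs.lean`); the gap itself is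
  REPAIRED under the bounded-occurrence promise of the source problem of Thm. 20 with `ε ↦ ε/c`
  (`BIJL2018_lemma22_gap`, PROVED, sibling `BIJL18TPhiGapProofs.lean` — a repair, not in print).
* FACT-LIST marks: `-- FACT` (published, unproved here), `-- DISCHARGEABLE` (explicit linear
  algebra, provers may take it), `-- PROVED` (proved below or, with the theorem named, in the sibling
  proof file cited), `-- REFUTED AS WORDED` (the printed statement is false as typed; kernel refutation
  cited). Status 2026-08-26 (val-lit): of this file's named facts, Lemma 11 (both sentences),
  Lemmas 13, 14, Thm. 3, Thm. 18, Prop. 19, Thm. 20, Lemma 21, the safe reading of Lemma 22 and App. B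
  are PROVED in sibling files; Thm. 4 (and its strengthened form) and Thm. 23 remain FACTS; Lemma 22 as
  printed is REFUTED AS WORDED.

## References
* [BlaserIkenmeyerJindalLysikov2018] STOC 2018 / ECCC TR18-064, Def. 1–2, Thms. 3–7, Defs. 8–9,
  Obs. 10, Lemma 11, Obs. 12, Lemmas 13–14, Obs. 15, Lemma 16, Obs. 17, Thm. 18, Prop. 19,
  Thm. 20, Lemmas 21–22, Thm. 23, App. B.
* [ForbesShpilkaVolk2018] Def. 1, Def. 3, Thm. 4 (the framework, tree file
  `AlgebraicNaturalProofs.lean`).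
* [Blaser2013] Def. 4.5 / §6 (tensor rank, border rank: tree files `MatrixMultiplicationExponent`,
  `SchoenhageTau`).
-/

noncomputable section

namespace Literature.Barriers.ValiantsHypothesis

open Literature.Computability.AlgebraicComplexity Literature.Computability.Complexity MvPolynomial
open _root_.Computability

universe u v w

/-! ### Def. 1 (second clause): a natural proof FOR a specific `f₀` -/

section Framework

variable {F : Type u} [CommSemiring F] {σ : Type v}

-- PROVED (definition + API)
/-- **BIJL Def. 1, second clause.** With the FSV/BIJL frame `IsNaturalProof M 𝒞 𝒟 D` (Def. 1,
first clause: `D ∈ 𝒟`, `D ≠ 0`, `D` vanishes on the coefficient vectors of all `f ∈ 𝒞`):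
"for `f₀ ∈ ⟨M⟩`, we call `D` as above an algebraic `𝒟`-natural proof FOR `f₀` against `𝒞`, if we
have `D(f₀) ≠ 0`. That is, `D` proves that `f₀` is not in `𝒞`."
[cite: BlaserIkenmeyerJindalLysikov2018, Def. 1] locator: ECCC p.2; s2 p0002.txt:L5 -/
def IsNaturalProofFor (M : Set (σ →₀ ℕ)) (𝒞 : Set (MvPolynomial σ F))
    (𝒟 : Set (MvPolynomial M F)) (D : MvPolynomial M F) (f₀ : MvPolynomial σ F) : Prop :=
  IsNaturalProof M 𝒞 𝒟 D ∧ eval (coeffVector M f₀) D ≠ 0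

/-- "That is, `D` proves that `f₀` is not in `𝒞`" (Def. 1).
[cite: BlaserIkenmeyerJindalLysikov2018, Def. 1] locator: ECCC p.2 -/
theorem IsNaturalProofFor.not_mem {M : Set (σ →₀ ℕ)} {𝒞 : Set (MvPolynomial σ F)}
    {𝒟 : Set (MvPolynomial M F)} {D : MvPolynomial M F} {f₀ : MvPolynomial σ F}
    (h : IsNaturalProofFor M 𝒞 𝒟 D f₀) : f₀ ∉ 𝒞 :=
  fun hf => h.2 (h.1.2.2 f₀ hf)

end Framework

/-! ### Def. 8: completion rank -/

section CompletionRank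

variable {K : Type u} [Field K] {ι : Type v} {κ : Type w} [Fintype κ]

-- PROVED (definition)
/-- The matrix `A₀ + Σ_k c_k A_k` of the affine pencil with constant slice `A₀` and slices
`(A_k)_{k ∈ κ}` at the point `c` (BIJL §1.3/§2: "a matrix `A₀ + x₁A₁ + ⋯ + x_mA_m` with affine
linear forms as entries"; `κ = Fin m`). [cite: BlaserIkenmeyerJindalLysikov2018, Def. 8]
locator: ECCC p.7 -/
def pencilEval (A₀ : Matrix ι ι K) (A : κ → Matrix ι ι K) (c : κ → K) : Matrix ι ι K :=
  A₀ + ∑ k, c k • A k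

/-- The exact tensor mapped into `K(ε)`, with `λ` mapped too, evaluates to the mapped pencil.
[cite: BlaserIkenmeyerJindalLysikov2018, Def. 9] -/
theorem pencilEval_map_C (A₀ : Matrix ι ι K) (A : κ → Matrix ι ι K) (c : κ → K) :
    pencilEval (A₀.map RatFunc.C) (fun k => (A k).map RatFunc.C) (fun k => RatFunc.C (c k)) =
      (pencilEval A₀ A c).map RatFunc.C := by
  ext i j
  simp [pencilEval, Matrix.sum_apply, map_sum]

variable [Fintype ι]

-- PROVED (definition)
/-- **BIJL Def. 8 (completion rank).** "The completion rank of `A₀, A₁, …, A_m` is the minimum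
number `r` such that there are scalars `λ₁, …, λ_m` with `rk(A₀ + λ₁A₁ + ⋯ + λ_mA_m) ≤ r`.
We denote the completion rank by `CR(A₀, A₁, …, A_m)`." The defining set is nonempty, so the
`sInf` is a minimum (`exists_rank_pencilEval_eq_completionRank`).
[cite: BlaserIkenmeyerJindalLysikov2018, Def. 8] locator: ECCC p.7; s2 p0007.txt:L5 -/
def completionRank (A₀ : Matrix ι ι K) (A : κ → Matrix ι ι K) : ℕ :=
  sInf {r | ∃ c : κ → K, (pencilEval A₀ A c).rank ≤ r}

/-- `CR ≤ rk(A₀ + Σ c_k A_k)` for every `c`. [cite: BlaserIkenmeyerJindalLysikov2018, Def. 8] -/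
theorem completionRank_le (A₀ : Matrix ι ι K) (A : κ → Matrix ι ι K) (c : κ → K) :
    completionRank A₀ A ≤ (pencilEval A₀ A c).rank :=
  Nat.sInf_le ⟨c, le_rfl⟩

/-- The minimum in Def. 8 is attained. [cite: BlaserIkenmeyerJindalLysikov2018, Def. 8] -/
theorem exists_rank_pencilEval_eq_completionRank (A₀ : Matrix ι ι K) (A : κ → Matrix ι ι K) :
    ∃ c : κ → K, (pencilEval A₀ A c).rank = completionRank A₀ A := by
  have hne : {r | ∃ c : κ → K, (pencilEval A₀ A c).rank ≤ r}.Nonempty :=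
    ⟨(pencilEval A₀ A fun _ => 0).rank, fun _ => 0, le_rfl⟩
  obtain ⟨c, hc⟩ := Nat.sInf_mem hne
  exact ⟨c, le_antisymm hc (completionRank_le A₀ A c)⟩

/-- `CR ≤ n` (`n = |ι|`). [cite: BlaserIkenmeyerJindalLysikov2018, Def. 8] -/
theorem completionRank_le_card (A₀ : Matrix ι ι K) (A : κ → Matrix ι ι K) :
    completionRank A₀ A ≤ Fintype.card ι :=
  (completionRank_le A₀ A fun _ => 0).trans (Matrix.rank_le_card_width _)

end CompletionRank

/-! ### Def. 9: border completion rank (algebraic definition over `K(ε)`) -/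

section Border

variable {K : Type u} [Field K] {ι : Type v} [Fintype ι] {κ : Type w} [Fintype κ]

-- PROVED (definition)
/-- `f = a + O(ε)` for `f ∈ K(ε)` and `a ∈ K` (ECCC p. 8: "for `f, g ∈ K(ε)`, we write
`f = g + O(εⁱ)` if the coefficients of `f` and `g` agree for powers `εʲ` with `j < i` when expanded
as formal Laurent series"; here `g = a`, `i = 1`: no pole at `0` and constant coefficient `a`),
rendered as: the reduced denominator of `f` does not vanish at `ε = 0` and the value of `f` at `0`
is `a` (`RatFunc.eval`). [cite: BlaserIkenmeyerJindalLysikov2018, Def. 9] locator: ECCC p.8 -/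
def IsApproxOf (a : K) (f : RatFunc K) : Prop :=
  f.denom.eval 0 ≠ 0 ∧ f.eval (RingHom.id K) 0 = a

/-- Entrywise `Ã = A + O(ε)` for matrices. [cite: BlaserIkenmeyerJindalLysikov2018, Def. 9]
locator: ECCC p.8 -/
def IsMatrixApproxOf {m n : Type*} (A : Matrix m n K) (At : Matrix m n (RatFunc K)) : Prop :=
  ∀ i j, IsApproxOf (A i j) (At i j)

/-- The constant `a ∈ K ⊂ K(ε)` approximates `a`. [cite: BlaserIkenmeyerJindalLysikov2018, Def. 9] -/
theorem isApproxOf_C (a : K) : IsApproxOf a (RatFunc.C a) := by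
  refine ⟨?_, ?_⟩
  · rw [← RatFunc.algebraMap_C, RatFunc.denom_algebraMap]; simp
  · rw [RatFunc.eval_C]; rfl

/-- The exact matrix `A` (mapped into `K(ε)`) approximates `A`.
[cite: BlaserIkenmeyerJindalLysikov2018, Def. 9] -/
theorem isMatrixApproxOf_map_C {m n : Type*} (A : Matrix m n K) : IsMatrixApproxOf A (A.map RatFunc.C) :=
  fun i j => isApproxOf_C (A i j)

-- PROVED (definition)
/-- **BIJL Def. 9 (border completion rank), data of a witness for `\underline{CR}(A₀,…,A_m) ≤ r`**:
approximations `Ã₀, (Ã_k)` over `K(ε)` with `Ãᵢ = Aᵢ + O(ε)` AND `Ãᵢ ∈ K(ε)^{n×n}_{rk(Aᵢ)}`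
("`0 ≤ i ≤ m`", typed literally, including `i = 0`; see the module docstring), and
`λ₁, …, λ_m ∈ K(ε)` (arbitrary rational functions, poles allowed) with
`rk(Ã₀ + Σ λ_k Ã_k) ≤ r` over the field `K(ε)`.
[cite: BlaserIkenmeyerJindalLysikov2018, Def. 9] locator: ECCC p.8; s2 p0007.txt:L23 -/
def IsBorderWitness (A₀ : Matrix ι ι K) (A : κ → Matrix ι ι K) (r : ℕ)
    (B₀ : Matrix ι ι (RatFunc K)) (B : κ → Matrix ι ι (RatFunc K)) (c : κ → RatFunc K) : Prop :=
  IsMatrixApproxOf A₀ B₀ ∧ (∀ k, IsMatrixApproxOf (A k) (B k)) ∧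
    B₀.rank ≤ A₀.rank ∧ (∀ k, (B k).rank ≤ (A k).rank) ∧ (pencilEval B₀ B c).rank ≤ r

-- PROVED (definition)
/-- **BIJL Def. 9 (border completion rank `\underline{CR}`).** "The border completion rank of
`A₀, A₁, …, A_m` is the minimum number `r` such that there are approximations
`Ãᵢ ∈ K(ε)^{n×n}_{rk(Aᵢ)}` with `Ãᵢ = Aᵢ + O(ε)`, `0 ≤ i ≤ m`, and rational functions
`λ₁, …, λ_m ∈ K(ε)` with `rk(Ã₀ + λ₁Ã₁ + ⋯ + λ_mÃ_m) ≤ r`." The defining set contains `CR`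
(exact tensors, `borderCompletionRank_le_completionRank`), so the `sInf` is a minimum.
[cite: BlaserIkenmeyerJindalLysikov2018, Def. 9] locator: ECCC p.8; s2 p0007.txt:L23 -/
def borderCompletionRank (A₀ : Matrix ι ι K) (A : κ → Matrix ι ι K) : ℕ :=
  sInf {r | ∃ (B₀ : Matrix ι ι (RatFunc K)) (B : κ → Matrix ι ι (RatFunc K)) (c : κ → RatFunc K),
    IsBorderWitness A₀ A r B₀ B c}

/-- A witness bounds the border completion rank. [cite: BlaserIkenmeyerJindalLysikov2018, Def. 9] -/
theorem borderCompletionRank_le_of_isBorderWitness {A₀ : Matrix ι ι K} {A : κ → Matrix ι ι K} {r : ℕ}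
    {B₀ : Matrix ι ι (RatFunc K)} {B : κ → Matrix ι ι (RatFunc K)} {c : κ → RatFunc K}
    (h : IsBorderWitness A₀ A r B₀ B c) : borderCompletionRank A₀ A ≤ r :=
  Nat.sInf_le ⟨B₀, B, c, h⟩

/-- Rank is invariant under a homomorphism of fields (entrywise), via rank = largest
non-vanishing minor (`Literature.LinearAlgebra.Matrix.rank_le_iff_det_submatrix_eq_zero`).
(Private helper.) [folklore] -/
private theorem rank_map_ringHom {L : Type*} [Field L] {m n : Type*} [Fintype m] [Fintype n]
    (f : K →+* L) (A : Matrix m n K) : (A.map f).rank = A.rank := by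
  classical
  have key : ∀ (s : ℕ) (r : Fin (s + 1) → m) (c : Fin (s + 1) → n),
      ((A.map f).submatrix r c).det = 0 ↔ (A.submatrix r c).det = 0 := by
    intro s r c
    rw [Matrix.submatrix_map, ← RingHom.mapMatrix_apply, ← RingHom.map_det,
      map_eq_zero_iff f f.injective]
  apply le_antisymm
  · refine Literature.LinearAlgebra.Matrix.rank_le_of_det_submatrix_eq_zero _ fun r c => ?_
    rw [key]
    exact Literature.LinearAlgebra.Matrix.det_submatrix_eq_zero_of_rank_lt_card A r c (by simp)
  · refine Literature.LinearAlgebra.Matrix.rank_le_of_det_submatrix_eq_zero _ fun r c => ?_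
    rw [← key]
    exact Literature.LinearAlgebra.Matrix.det_submatrix_eq_zero_of_rank_lt_card _ r c (by simp)

/-- "`\underline{CR}(A) ≤ CR(A)`" (proof of Lemma 14: exact tensors are approximations of
themselves). [cite: BlaserIkenmeyerJindalLysikov2018, Lemma 14 (proof)] locator: ECCC p.10 -/
theorem borderCompletionRank_le_completionRank (A₀ : Matrix ι ι K) (A : κ → Matrix ι ι K) :
    borderCompletionRank A₀ A ≤ completionRank A₀ A := by
  obtain ⟨c, hc⟩ := exists_rank_pencilEval_eq_completionRank A₀ A
  refine borderCompletionRank_le_of_isBorderWitness (B₀ := A₀.map RatFunc.C)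
    (B := fun k => (A k).map RatFunc.C) (c := fun k => RatFunc.C (c k)) ⟨isMatrixApproxOf_map_C A₀,
    fun k => isMatrixApproxOf_map_C (A k), (rank_map_ringHom RatFunc.C A₀).le,
    fun k => (rank_map_ringHom RatFunc.C (A k)).le, ?_⟩
  rw [pencilEval_map_C, rank_map_ringHom, hc]

end Border

/-! ### Boolean encodings of tensor instances (for the NP-hardness statements) -/

section Encodings

/-- Boolean encoding of an instance `(n, m, entries, r)`: an `n × n × (m+1)` integer tensor given
row-major as a list of `(m+1)·n²` integers (constant slice first), and a rank bound `r`.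
[cite: BlaserIkenmeyerJindalLysikov2018, §1.4 (input of the decision problems)] locator: ECCC p.5 -/
def tensorInstEncoding : Encoding (ℕ × ℕ × List ℤ × ℕ) Bool :=
  encodingNatBool.pairBool (encodingNatBool.pairBool
    (encodingIntBool.listBool.pairBool encodingNatBool))

/-- The instance list has the right length `(m+1) n²`. [cite: BlaserIkenmeyerJindalLysikov2018, §1.4] -/
def WellFormedInst (x : ℕ × ℕ × List ℤ × ℕ) : Prop :=
  x.2.2.1.length = (x.2.1 + 1) * x.1 ^ 2

variable (K : Type u) [Field K]

/-- The constant slice `A₀` of the tensor encoded by `(n, m, l)`, read over `K` (entry `(i, j)` at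
position `i·n + j`; missing entries are `0`). [cite: BlaserIkenmeyerJindalLysikov2018, §1.4] -/
def slice₀OfList (n : ℕ) (l : List ℤ) : Matrix (Fin n) (Fin n) K :=
  fun i j => ((l.getD (i.1 * n + j.1) 0 : ℤ) : K)

/-- The slices `A₁, …, A_m` of the tensor encoded by `(n, m, l)`, read over `K` (slice `k+1`,
entry `(i, j)` at position `(k+1)·n² + i·n + j`). [cite: BlaserIkenmeyerJindalLysikov2018, §1.4] -/
def slicesOfList (n m : ℕ) (l : List ℤ) : Fin m → Matrix (Fin n) (Fin n) K :=
  fun k i j => ((l.getD ((k.1 + 1) * n ^ 2 + i.1 * n + j.1) 0 : ℤ) : K)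

/-- **The decision problem `CR(t) ≤ r`** over `K` as a Boolean language (instances with integer
entries, read in `K`). [cite: BlaserIkenmeyerJindalLysikov2018, Lemma 11] locator: ECCC p.9 -/
def crLanguage : Language Bool :=
  tensorInstEncoding.toLanguage {x | WellFormedInst x ∧
    completionRank (slice₀OfList K x.1 x.2.2.1) (slicesOfList K x.1 x.2.1 x.2.2.1) ≤ x.2.2.2}

/-- **The decision problem `\underline{CR}(t) ≤ r`** over `K` as a Boolean language.
[cite: BlaserIkenmeyerJindalLysikov2018, Thm. 3] locator: ECCC p.6 -/
def borderCRLanguage : Language Bool :=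
  tensorInstEncoding.toLanguage {x | WellFormedInst x ∧
    borderCompletionRank (slice₀OfList K x.1 x.2.2.1) (slicesOfList K x.1 x.2.1 x.2.2.1) ≤ x.2.2.2}

-- PROVED (`BIJL2018_thm3_holds`, sibling `BIJL18CompletionRankNPHardProofs.lean`, val-lit p450270: Max-2-SAT ≤ₚ border-CR via Lemma 14 and `MAX2SAT_isNPHard`)
/-- **BIJL Thm. 3.** "Let `K` be a field. Given a tensor `t` over `K` and an integer `r`, deciding
whether the border completion rank `\underline{CR}(t) ≤ r` is NP-hard." (Proof: Lemma 14 and the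
NP-hardness of Max-2-SAT [ACG⁺99].) Typed: the language of (Boolean-encoded, integer-entry)
instances with `\underline{CR} ≤ r` over `K` is Karp-NP-hard.
[cite: BlaserIkenmeyerJindalLysikov2018, Thm. 3] locator: ECCC p.6 (proof p.10); s2 p0005.txt:L3 -/
def BIJL2018_thm3 : Prop :=
  IsNPHard (borderCRLanguage K)

end Encodings

/-! ### §3: the Max-2-SAT clause gadgets, Obs. 10, Lemma 11, Obs. 12, Lemmas 13–14 -/

section Gadget

variable (K : Type u) [Field K] {t : ℕ}

/-- Number of clauses of the 2-CNF `φ` (pairs of literals over `x₀,…,x_{t-1}`; `Literal` =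
(variable, polarity), polarity `true` = positive) satisfied by the Boolean assignment `σ`.
[cite: BlaserIkenmeyerJindalLysikov2018, §3 (Max-2-SAT)] locator: ECCC p.8 -/
def numSat₂ (φ : List (Literal (Fin t) × Literal (Fin t))) (σ : Fin t → Bool) : ℕ :=
  φ.countP fun c => c.1.eval σ || c.2.eval σ

/-- The literal in position `a ∈ {0, 1}` of clause `i`. [cite: BlaserIkenmeyerJindalLysikov2018, §3] -/
def clauseLit (φ : List (Literal (Fin t) × Literal (Fin t))) (i : Fin φ.length) (a : Fin 2) :
    Literal (Fin t) :=
  if a = 0 then (φ.get i).1 else (φ.get i).2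

/-- Constant term of the affine form `1 - ℓ`: for `ℓ = x_k` it is `1`, for `ℓ = 1 - x_k`
(negated literal) it is `0`. [cite: BlaserIkenmeyerJindalLysikov2018, §3 (clause gadget)] locator: ECCC p.9 -/
def litConst (l : Literal (Fin t)) : K := if l.2 then 1 else 0

/-- Coefficient of `x_k` in the affine form `1 - ℓ`: `-1` for `ℓ = x_k`, `+1` for `ℓ = 1 - x_k`,
`0` if `ℓ` is not on `x_k`. [cite: BlaserIkenmeyerJindalLysikov2018, §3 (clause gadget)] locator: ECCC p.9 -/
def litCoeff (l : Literal (Fin t)) (k : Fin t) : K :=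
  if l.1 = k then (if l.2 then -1 else 1) else 0

/-- The value of the literal form `ℓ` at a point `c ∈ K^t`: `x_k ↦ c_k`, `¬x_k ↦ 1 - c_k`.
[cite: BlaserIkenmeyerJindalLysikov2018, §3] locator: ECCC p.9 -/
def litVal (l : Literal (Fin t)) (c : Fin t → K) : K := if l.2 then c l.1 else 1 - c l.1

-- PROVED (definition)
/-- **The §3 construction, constant slice `A₀`.** Rows/columns `(i, a)` = clause `i`, local index
`a ∈ {0,1}`; the block of clause `cᵢ = L₁ ∨ L₂` is the clause gadget `[[1-ℓ₁, 1],[0, 1-ℓ₂]]`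
(constants of the affine forms; off-diagonal blocks `0`): "take these `s` clause gadgets … and form
a block diagonal matrix … Write this matrix as `A₀ + x₁A₁ + … + x_tA_t`".
[cite: BlaserIkenmeyerJindalLysikov2018, §3 (construction before Obs. 10)] locator: ECCC p.9; s2 p0008.txt:L9 -/
def bijlA₀ (φ : List (Literal (Fin t) × Literal (Fin t))) :
    Matrix (Fin φ.length × Fin 2) (Fin φ.length × Fin 2) K :=
  fun p q => if p.1 = q.1 then
    (if p.2 = q.2 then litConst K (clauseLit φ p.1 p.2) else if p.2 = 0 then 1 else 0) else 0

-- PROVED (definition)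
/-- **The §3 construction, slices `A₁, …, A_t`** (`A_k` = coefficient matrix of `x_k`): diagonal,
entry `((i,a),(i,a))` = coefficient of `x_k` in `1 - ℓ` for the literal `ℓ` in position `a` of
clause `i`. [cite: BlaserIkenmeyerJindalLysikov2018, §3 (construction before Obs. 10)] locator: ECCC p.9 -/
def bijlSlices (φ : List (Literal (Fin t) × Literal (Fin t))) :
    Fin t → Matrix (Fin φ.length × Fin 2) (Fin φ.length × Fin 2) K :=
  fun k p q => if p = q then litCoeff K (clauseLit φ p.1 p.2) k else 0

/-- The `2 × 2` clause gadget `[[1 - ℓ₁, 1], [0, 1 - ℓ₂]]` at literal values `ℓ₁, ℓ₂ ∈ K`.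
[cite: BlaserIkenmeyerJindalLysikov2018, §3 (clause gadget)] locator: ECCC p.9 -/
def clauseGadget (ℓ₁ ℓ₂ : K) : Matrix (Fin 2) (Fin 2) K :=
  !![1 - ℓ₁, 1; 0, 1 - ℓ₂]

/-- The clause gadget has rank `≥ 1` (its entry `(1,2)` is `1`).
[cite: BlaserIkenmeyerJindalLysikov2018, Obs. 10] locator: ECCC p.9 -/
theorem one_le_rank_clauseGadget (ℓ₁ ℓ₂ : K) : 1 ≤ (clauseGadget K ℓ₁ ℓ₂).rank := by
  have h := Literature.LinearAlgebra.Matrix.card_le_rank_of_det_submatrix_ne_zero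
    (clauseGadget K ℓ₁ ℓ₂) (fun _ : Fin 1 => (0 : Fin 2)) (fun _ => (1 : Fin 2)) (by
      rw [Matrix.det_unique]
      simp [clauseGadget])
  simpa using h

/-- If a literal of the clause is `1`, the gadget is a rank-one outer product.
[cite: BlaserIkenmeyerJindalLysikov2018, Obs. 10] locator: ECCC p.9 -/
theorem rank_clauseGadget_le_one {ℓ₁ ℓ₂ : K} (h : ℓ₁ = 1 ∨ ℓ₂ = 1) :
    (clauseGadget K ℓ₁ ℓ₂).rank ≤ 1 := by
  rcases h with h | h
  · have e : clauseGadget K ℓ₁ ℓ₂ = Matrix.vecMulVec ![1, 1 - ℓ₂] ![0, 1] := by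
      subst h
      ext i j; fin_cases i <;> fin_cases j <;> simp [clauseGadget, Matrix.vecMulVec_apply]
    rw [e]; exact Matrix.rank_vecMulVec_le _ _
  · have e : clauseGadget K ℓ₁ ℓ₂ = Matrix.vecMulVec ![1, 0] ![1 - ℓ₁, 1] := by
      subst h
      ext i j; fin_cases i <;> fin_cases j <;> simp [clauseGadget, Matrix.vecMulVec_apply]
    rw [e]; exact Matrix.rank_vecMulVec_le _ _

/-- If no literal of the clause is `1`, the gadget is invertible, of rank `2`.
[cite: BlaserIkenmeyerJindalLysikov2018, Obs. 10] locator: ECCC p.9 -/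
theorem rank_clauseGadget_eq_two {ℓ₁ ℓ₂ : K} (h : ¬ (ℓ₁ = 1 ∨ ℓ₂ = 1)) :
    (clauseGadget K ℓ₁ ℓ₂).rank = 2 := by
  have hdet : (clauseGadget K ℓ₁ ℓ₂).det ≠ 0 := by
    rw [clauseGadget, Matrix.det_fin_two_of]
    push Not at h
    have h1 : (1 : K) - ℓ₁ ≠ 0 := sub_ne_zero.2 (Ne.symm h.1)
    have h2 : (1 : K) - ℓ₂ ≠ 0 := sub_ne_zero.2 (Ne.symm h.2)
    simpa using mul_ne_zero h1 h2
  have hU : IsUnit (clauseGadget K ℓ₁ ℓ₂) :=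
    (Matrix.isUnit_iff_isUnit_det _).2 (isUnit_iff_ne_zero.2 hdet)
  simpa using Matrix.rank_of_isUnit _ hU

-- PROVED
/-- **BIJL Obs. 10.** "The clause gadget has rank `1` iff at least one of the literals `ℓ₁, ℓ₂` is
set to be `1`. Otherwise, it has rank `2`." [cite: BlaserIkenmeyerJindalLysikov2018, Obs. 10]
locator: ECCC p.9; s2 p0009.txt:L3 -/
theorem BIJL2018_obs10 (ℓ₁ ℓ₂ : K) :
    ((clauseGadget K ℓ₁ ℓ₂).rank = 1 ↔ (ℓ₁ = 1 ∨ ℓ₂ = 1)) ∧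
      (¬ (ℓ₁ = 1 ∨ ℓ₂ = 1) → (clauseGadget K ℓ₁ ℓ₂).rank = 2) := by
  refine ⟨⟨fun h => ?_, fun h => le_antisymm (rank_clauseGadget_le_one K h)
    (one_le_rank_clauseGadget K ℓ₁ ℓ₂)⟩, rank_clauseGadget_eq_two K⟩
  by_contra hne
  have := rank_clauseGadget_eq_two K hne
  omega

-- PROVED (`BIJL2018_lemma11_holds`, sibling `BIJL18MatrixCompletionProofs.lean`, val-lit p421608)
/-- **BIJL Lemma 11 (first sentence).** "`CR(A₀, A₁, …, A_t) ≤ 2s − b` iff `b` clauses of `φ`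
can be satisfied" (`s` = number of clauses; "can be satisfied" = some Boolean assignment
satisfies at least `b` clauses, as in Max-2-SAT). Stated in `ℤ` to avoid truncated subtraction.
[cite: BlaserIkenmeyerJindalLysikov2018, Lemma 11] locator: ECCC p.9 -/
def BIJL2018_lemma11 : Prop :=
  ∀ (t : ℕ) (φ : List (Literal (Fin t) × Literal (Fin t))) (b : ℕ),
    (completionRank (bijlA₀ K φ) (bijlSlices K φ) : ℤ) ≤ 2 * φ.length - b ↔
      ∃ σ : Fin t → Bool, b ≤ numSat₂ φ σ

-- PROVED (`BIJL2018_lemma11_npHard_holds`, sibling `BIJL18CompletionRankNPHardProofs.lean`, val-lit p450270: Max-2-SAT ≤ₚ CR via Lemma 11; Max-2-SAT NP-hard = `MAX2SAT_isNPHard`, `Computability/Complexity/MaxTwoSat.lean`)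
/-- **BIJL Lemma 11 (second sentence).** "Thus the problem `CR(A₀, A₁, …, A_t) ≤? k` is
NP-hard" (from Max-2-SAT [ACG⁺99]). Typed as Karp NP-hardness of `crLanguage K`.
[cite: BlaserIkenmeyerJindalLysikov2018, Lemma 11] locator: ECCC p.9 -/
def BIJL2018_lemma11_npHard : Prop :=
  IsNPHard (crLanguage K)

/-- **BIJL Obs. 12 (shape of the slices), part 1: each `A_k`, `k ≥ 1`, is diagonal.**
"If `i ≥ 1`, then each `Aᵢ` is a diagonal matrix with diagonal entries being `±1`" — the
NON-ZERO diagonal entries are `±1` (part 2). [cite: BlaserIkenmeyerJindalLysikov2018, Obs. 12]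
locator: ECCC p.9; s2 p0009.txt:L7 -/
theorem bijlSlices_apply_of_ne (φ : List (Literal (Fin t) × Literal (Fin t))) (k : Fin t)
    {p q : Fin φ.length × Fin 2} (h : p ≠ q) : bijlSlices K φ k p q = 0 := by
  simp [bijlSlices, h]

/-- **BIJL Obs. 12, part 2:** the diagonal entries of `A_k` (`k ≥ 1`) lie in `{0, 1, -1}`.
[cite: BlaserIkenmeyerJindalLysikov2018, Obs. 12] locator: ECCC p.9 -/
theorem bijlSlices_apply_self (φ : List (Literal (Fin t) × Literal (Fin t))) (k : Fin t)
    (p : Fin φ.length × Fin 2) :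
    bijlSlices K φ k p p = 0 ∨ bijlSlices K φ k p p = 1 ∨ bijlSlices K φ k p p = -1 := by
  unfold bijlSlices litCoeff
  split_ifs <;> simp

/-- **BIJL Obs. 12, part 3:** "if the `j`th diagonal entry of `Aᵢ` is non-zero then the `j`th
diagonal entry of any other `A_k` is zero, for `i, k ≥ 1`."
[cite: BlaserIkenmeyerJindalLysikov2018, Obs. 12] locator: ECCC p.9 -/
theorem bijlSlices_apply_self_eq_zero_of_ne (φ : List (Literal (Fin t) × Literal (Fin t)))
    {k k' : Fin t} (hk : k ≠ k') (p : Fin φ.length × Fin 2) (h : bijlSlices K φ k p p ≠ 0) :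
    bijlSlices K φ k' p p = 0 := by
  unfold bijlSlices litCoeff at h ⊢
  simp only [if_true] at h ⊢
  by_cases h1 : (clauseLit φ p.1 p.2).1 = k
  · rw [if_neg]
    rintro h2
    exact hk (h1.symm.trans h2)
  · simp [h1] at h

-- PROVED (`BIJL2018_lemma13_holds`, sibling `BIJL18BorderCompletionRankProofs.lean`, val-lit p435594)
/-- **BIJL Lemma 13.** For approximations `Ãᵢ = Aᵢ + O(ε)` of the §3 tensor in the sense of
Def. 9 (`Ãᵢ` of rank `≤ rk Aᵢ` over `K(ε)`, `0 ≤ i ≤ t`; the proof uses this for `i ≥ 1`: "Since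
`S₁, T₁` are of full rank, we get `rk A₁ = rk Ã₁`"): "There are
(invertible) matrices `S = I_n + O(ε)` and `T = I_n + O(ε)` such that
`S·(Ã₀ + λ₁Ã₁ + ⋯ + λ_tÃ_t)·T = Â₀ + λ₁A₁ + ⋯ + λ_tA_t` for some `Â₀ = A₀ + O(ε)`" (for all
`λ ∈ K(ε)^t`; `S, T, Â₀` do not depend on `λ`).
[cite: BlaserIkenmeyerJindalLysikov2018, Lemma 13] locator: ECCC p.9; s2 p0009.txt:L11 -/
def BIJL2018_lemma13 : Prop :=
  ∀ (t : ℕ) (φ : List (Literal (Fin t) × Literal (Fin t)))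
    (B₀ : Matrix (Fin φ.length × Fin 2) (Fin φ.length × Fin 2) (RatFunc K))
    (B : Fin t → Matrix (Fin φ.length × Fin 2) (Fin φ.length × Fin 2) (RatFunc K)),
    IsMatrixApproxOf (bijlA₀ K φ) B₀ → (∀ k, IsMatrixApproxOf (bijlSlices K φ k) (B k)) →
    B₀.rank ≤ (bijlA₀ K φ).rank → (∀ k, (B k).rank ≤ (bijlSlices K φ k).rank) →
    ∃ (S T Bhat₀ : Matrix (Fin φ.length × Fin 2) (Fin φ.length × Fin 2) (RatFunc K)),
      IsMatrixApproxOf 1 S ∧ IsMatrixApproxOf 1 T ∧ IsUnit S.det ∧ IsUnit T.det ∧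
      IsMatrixApproxOf (bijlA₀ K φ) Bhat₀ ∧
      ∀ c : Fin t → RatFunc K,
        S * pencilEval B₀ B c * T = pencilEval Bhat₀ (fun k => (bijlSlices K φ k).map RatFunc.C) c

-- PROVED (`BIJL2018_lemma14_holds`, sibling `BIJL18BorderCompletionRankProofs.lean`, val-lit p436964)
/-- **BIJL Lemma 14.** "`\underline{CR}(A₀, A₁, …, A_t) ≤ 2s − b` iff `b` clauses of `φ` can be
satisfied." (In `ℤ`, as Lemma 11.) [cite: BlaserIkenmeyerJindalLysikov2018, Lemma 14]
locator: ECCC p.10 -/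
def BIJL2018_lemma14 : Prop :=
  ∀ (t : ℕ) (φ : List (Literal (Fin t) × Literal (Fin t))) (b : ℕ),
    (borderCompletionRank (bijlA₀ K φ) (bijlSlices K φ) : ℤ) ≤ 2 * φ.length - b ↔
      ∃ σ : Fin t → Bool, b ≤ numSat₂ φ σ

end Gadget

/-! ### §3: algebraic natural proofs for border completion rank; Thm. 4; Obs. 15, Lemma 16, Obs. 17 -/

section NaturalProofs

variable (K : Type u) [Field K]

/-- Coordinates of a tensor `(A₀, (A_k)_{k ∈ κ})` as a point of `K^{Option κ × ι × ι}` (slice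
`none` = `A₀`). [cite: BlaserIkenmeyerJindalLysikov2018, §3 (p ∈ K[X_{h,i,j}])] locator: ECCC p.11 -/
def tensorPoint {ι : Type v} {κ : Type w} (A₀ : Matrix ι ι K) (A : κ → Matrix ι ι K) :
    Option κ × ι × ι → K :=
  fun v => (v.1.elim A₀ A) v.2.1 v.2.2

-- PROVED (definition)
/-- **An algebraic natural proof of size `≤ s` for "`\underline{CR}(t) > r`"** (ECCC p. 11):
"a polynomial equation `p ∈ K[X_{h,i,j}]` such that 1. `p(t) ≠ 0`, 2. `p(s) = 0` for every
`s ∈ K^{n×n×(m+1)}` with `\underline{CR}(s) ≤ r`. 3. `p` is computed by a constant-free algebraic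
circuit of size `poly(n)`" — here with an explicit fan-in-two constant-free (`HasSignConstants`)
circuit of size `≤ s`. [cite: BlaserIkenmeyerJindalLysikov2018, §3 (before Obs. 15)] locator: ECCC p.11; s2 p0009.txt:L37 -/
def IsBorderCRProof {n m : ℕ} (A₀ : Matrix (Fin n) (Fin n) K) (A : Fin m → Matrix (Fin n) (Fin n) K)
    (r s : ℕ) (p : MvPolynomial (Option (Fin m) × Fin n × Fin n) K) : Prop :=
  eval (tensorPoint K A₀ A) p ≠ 0 ∧
    (∀ (B₀ : Matrix (Fin n) (Fin n) K) (B : Fin m → Matrix (Fin n) (Fin n) K),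
      borderCompletionRank B₀ B ≤ r → eval (tensorPoint K B₀ B) p = 0) ∧
    ∃ P : ArithCircuit K (Option (Fin m) × Fin n × Fin n),
      P.IsFanInTwo ∧ P.HasSignConstants ∧ P.Computes p ∧ P.size ≤ s

-- FACT (R1: class hypothesis coNP ⊄ ∃BPP) — a CONDITIONAL barrier
/-- **BIJL Thm. 4 (conditional barrier for border completion rank).** "For infinitely many `n`,
there is an `m`, a tensor `t ∈ K^{n×n×m}` with coefficients in `{−1, 0, 1}`, and a value `r` such
that there is no algebraic `poly(n)`-natural proof for the fact that `\underline{CR}(t) > r` unless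
`coNP ⊆ ∃BPP`." Typed: if `¬ coNP ⊆ ∃·BPP` then for every size exponent `c`, for infinitely many
`n` some `{−1,0,1}`-tensor `(A₀, A₁, …, A_m)` of `n × n` matrices and some `r` admit no natural
proof of constant-free size `≤ n^c + c`, where the "fact" `\underline{CR}(t) > r` HOLDS (made
explicit: `r < borderCompletionRank`; in the proof `t = T_φ`, `r = 2s − b` with fewer than `b`
clauses satisfiable) (the negation used in the printed proof: "let `n` be large enough such that
for all tensors under consideration, there is an algebraic `poly(n)`-natural proof"). `K` infinite
(module docstring). technique_class: algebraically natural proofs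
(constant-free `VP`-size distinguishers, FSV/GKSS) against `{\underline{CR} ≤ r}`. blocks:
`poly(n)`-size constant-free equations certifying `\underline{CR}(T_φ) > r` for all Max-2-SAT
tensors `T_φ` [cite: BlaserIkenmeyerJindalLysikov2018, Thm. 4]. because: a guessed small proof
is verified by PIT against the parametrisation `g` of Lemma 16, putting a coNP-hard problem in
`∃BPP` [cite: BlaserIkenmeyerJindalLysikov2018, §3 (proof of Thm. 4)]. evasions_known:
intermediate succinct encodings as in GCT ("even the geometric complexity approach eventually
produces an algebraic natural proof. However, it is produced from some intermediate
representation, which might be more compact", ECCC p.6; §7 / Thm. 7) [cite: BlaserIkenmeyerJindalLysikov2018, §1.4 and §7].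
scope_caveats: conditional on `coNP ⊄ ∃BPP`; constant-free circuits only ("Over fields of
characteristic `0`, we can deal with arbitrary constants similar to [GP14], at the price of
replacing `∃BPP` by `BP-NP`", not typed); about the SPECIFIC varieties `{\underline{CR} ≤ r}`,
not about `VP`. status: established (conditional theorem).
[cite: BlaserIkenmeyerJindalLysikov2018, Thm. 4] locator: ECCC p.6 (proof pp.11–12); s2 p0005.txt:L7 -/
def BIJL2018_thm4 [Infinite K] : Prop :=
  ¬ (coNP ⊆ polyExists BPP) →
    ∀ c n₀ : ℕ, ∃ n : ℕ, n₀ ≤ n ∧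
      ∃ (m : ℕ) (A₀ : Matrix (Fin n) (Fin n) K) (A : Fin m → Matrix (Fin n) (Fin n) K) (r : ℕ),
        (∀ v, tensorPoint K A₀ A v = 0 ∨ tensorPoint K A₀ A v = 1 ∨ tensorPoint K A₀ A v = -1) ∧
        r < borderCompletionRank A₀ A ∧ ∀ p, ¬ IsBorderCRProof K A₀ A r (n ^ c + c) p

/-- A product `Uᵀ V` with `U, V ∈ K^{ρ×n}` has rank `≤ ρ` (Obs. 15, easy direction).
[cite: BlaserIkenmeyerJindalLysikov2018, Obs. 15] locator: ECCC p.11 -/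
theorem rank_le_of_eq_transpose_mul {n ρ : ℕ} {M : Matrix (Fin n) (Fin n) K}
    {U V : Matrix (Fin ρ) (Fin n) K} (h : M = U.transpose * V) : M.rank ≤ ρ := by
  rw [h]
  exact (Matrix.rank_mul_le_right _ _).trans (by simpa using Matrix.rank_le_card_height V)

/-- A matrix of rank `≤ ρ` factors as `Uᵀ V` with `U, V ∈ K^{ρ×n}` (Obs. 15, via a basis of the
column space padded with zero rows). [cite: BlaserIkenmeyerJindalLysikov2018, Obs. 15] locator: ECCC p.11 -/
theorem exists_eq_transpose_mul_of_rank_le {n ρ : ℕ} (M : Matrix (Fin n) (Fin n) K)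
    (hM : M.rank ≤ ρ) : ∃ U V : Matrix (Fin ρ) (Fin n) K, M = U.transpose * V := by
  classical
  set W : Submodule K (Fin n → K) := Submodule.span K (Set.range M.col) with hW
  set r := Module.finrank K W with hr
  have hrρ : r ≤ ρ := by rw [hr, hW, ← Matrix.rank_eq_finrank_span_cols]; exact hM
  let b := Module.finBasis K W
  have hb : ∀ j k, M k j =
      ∑ l : Fin r, (b.repr ⟨M.col j, Submodule.subset_span ⟨j, rfl⟩⟩ l) * (b l : Fin n → K) k := by
    intro j k
    have hx := b.sum_repr ⟨M.col j, Submodule.subset_span ⟨j, rfl⟩⟩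
    have := congrArg (fun w : W => (w : Fin n → K) k) hx
    simp only [Submodule.coe_sum, Submodule.coe_smul, Finset.sum_apply, Pi.smul_apply,
      smul_eq_mul] at this
    rw [this]; rfl
  let e : Fin r → Fin ρ := Fin.castLE hrρ
  have he : Function.Injective e := Fin.castLE_injective hrρ
  let P : Matrix (Fin ρ) (Fin r) K := fun i l => if i = e l then 1 else 0
  have hP : P.transpose * P = 1 := by
    ext l l'
    simp only [Matrix.mul_apply, Matrix.transpose_apply, P, Matrix.one_apply]
    simp only [mul_ite, mul_one, mul_zero]
    rw [Finset.sum_ite_eq' Finset.univ (e l')]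
    simp only [Finset.mem_univ, if_true]
    by_cases h : l = l'
    · subst h; simp
    · rw [if_neg (fun h' => h (he h').symm), if_neg h]
  let U₀ : Matrix (Fin r) (Fin n) K := fun l k => (b l : Fin n → K) k
  let V₀ : Matrix (Fin r) (Fin n) K := fun l j => b.repr ⟨M.col j, Submodule.subset_span ⟨j, rfl⟩⟩ l
  have hM' : M = U₀.transpose * V₀ := by
    ext k j
    rw [hb j k, Matrix.mul_apply]
    refine Finset.sum_congr rfl fun l _ => ?_
    simp [U₀, V₀, Matrix.transpose_apply, mul_comm]
  refine ⟨P * U₀, P * V₀, ?_⟩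
  rw [Matrix.transpose_mul, Matrix.mul_assoc, ← Matrix.mul_assoc P.transpose, hP, Matrix.one_mul]
  exact hM'

-- PROVED
/-- **BIJL Obs. 15.** "Let `U_{i,j}, V_{i,j}`, `1 ≤ i ≤ ρ`, `1 ≤ j ≤ n` be indeterminates over `K`.
Consider the polynomial matrix `Σ_{i=1}^ρ (U_{i,1}, …, U_{i,n})ᵀ (V_{i,1}, …, V_{i,n})`. If we
substitute arbitrary constants for the indeterminates, then we get all matrices in `K^{n×n}_ρ`"
(the matrices of rank `≤ ρ`): `{Uᵀ V : U, V ∈ K^{ρ×n}} = {M : rk M ≤ ρ}`.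
[cite: BlaserIkenmeyerJindalLysikov2018, Obs. 15] locator: ECCC p.11 -/
theorem BIJL2018_obs15 (n ρ : ℕ) (M : Matrix (Fin n) (Fin n) K) :
    M.rank ≤ ρ ↔ ∃ U V : Matrix (Fin ρ) (Fin n) K, M = U.transpose * V :=
  ⟨exists_eq_transpose_mul_of_rank_le K M, fun ⟨_, _, h⟩ => rank_le_of_eq_transpose_mul K h⟩

/-- **The parametrisation `g` of Lemma 16** for rank profile `r₀, r₁, …, r_t`:
`g := (Q₀ − Z₁Q₁ − ⋯ − Z_tQ_t, Q₁, …, Q_t)` with `Qᵢ = UᵢᵀVᵢ` the generic rank-`rᵢ` matrix of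
Obs. 15 (fresh variables for each `Qᵢ`) and new variables `Z₁, …, Z_t`, here as a function of
the substituted constants `(U, V, z)`. [cite: BlaserIkenmeyerJindalLysikov2018, Lemma 16] locator: ECCC p.11 -/
def lemma16Map {n t : ℕ} (r₀ : ℕ) (r : Fin t → ℕ) (U₀ V₀ : Matrix (Fin r₀) (Fin n) K)
    (U V : ∀ k : Fin t, Matrix (Fin (r k)) (Fin n) K) (z : Fin t → K) :
    Matrix (Fin n) (Fin n) K × (Fin t → Matrix (Fin n) (Fin n) K) :=
  (U₀.transpose * V₀ - ∑ k, z k • ((U k).transpose * V k), fun k => (U k).transpose * V k)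

-- PROVED
/-- **BIJL Lemma 16.** "If we substitute arbitrary constants for the indeterminates [of `g`], then
we get all tensors of completion rank `≤ r₀` with the `i`th slice having rank `≤ rᵢ`,
`1 ≤ i ≤ t`." [cite: BlaserIkenmeyerJindalLysikov2018, Lemma 16] locator: ECCC p.11; s2 p0010.txt:L1 -/
theorem BIJL2018_lemma16 (n t r₀ : ℕ) (r : Fin t → ℕ) (A₀ : Matrix (Fin n) (Fin n) K)
    (A : Fin t → Matrix (Fin n) (Fin n) K) :
    (completionRank A₀ A ≤ r₀ ∧ ∀ k, (A k).rank ≤ r k) ↔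
      ∃ (U₀ V₀ : Matrix (Fin r₀) (Fin n) K) (U V : ∀ k : Fin t, Matrix (Fin (r k)) (Fin n) K)
        (z : Fin t → K), lemma16Map K r₀ r U₀ V₀ U V z = (A₀, A) := by
  constructor
  · rintro ⟨hcr, hrk⟩
    obtain ⟨c, hc⟩ := exists_rank_pencilEval_eq_completionRank A₀ A
    obtain ⟨U₀, V₀, h₀⟩ :=
      exists_eq_transpose_mul_of_rank_le K (pencilEval A₀ A c) (hc.le.trans hcr)
    choose U V hUV using fun k => exists_eq_transpose_mul_of_rank_le K (A k) (hrk k)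
    refine ⟨U₀, V₀, U, V, c, ?_⟩
    simp only [lemma16Map, Prod.mk.injEq]
    refine ⟨?_, funext fun k => (hUV k).symm⟩
    rw [← h₀, pencilEval]
    simp only [← hUV]
    exact add_sub_cancel_right _ _
  · rintro ⟨U₀, V₀, U, V, z, h⟩
    simp only [lemma16Map, Prod.mk.injEq] at h
    obtain ⟨h₀, hA⟩ := h
    subst hA
    refine ⟨(completionRank_le A₀ _ z).trans (rank_le_of_eq_transpose_mul K (U := U₀) (V := V₀) ?_),
      fun k => rank_le_of_eq_transpose_mul K rfl⟩
    rw [pencilEval, ← h₀]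
    exact sub_add_cancel _ _

/-- **The variety `C^{n,t,c}_r` of Obs. 17**: tensors `(A₀, A₁, …, A_t)` of `n × n` matrices of
border completion rank `≤ r` with `rk(Aᵢ) ≤ c` for `1 ≤ i ≤ t`.
[cite: BlaserIkenmeyerJindalLysikov2018, Obs. 17] locator: ECCC p.12; s2 p0010.txt:L27 -/
def bijlVariety (n t c r : ℕ) :
    Set (Matrix (Fin n) (Fin n) K × (Fin t → Matrix (Fin n) (Fin n) K)) :=
  {A | borderCompletionRank A.1 A.2 ≤ r ∧ ∀ k, (A.2 k).rank ≤ c}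

/-- The ideal of polynomials (in the tensor coordinates) vanishing on the image of the
parametrisation `g` of Lemma 16 with `r₀ = r`, `rᵢ = c` — the vanishing ideal of `C^{n,t,c}_r`
("The closure of the image of `g` is `C^{n,t,c}_r`").
[cite: BlaserIkenmeyerJindalLysikov2018, Obs. 17] locator: ECCC p.12 -/
def lemma16VanishingIdeal (n t c r : ℕ) : Ideal (MvPolynomial (Option (Fin t) × Fin n × Fin n) K) where
  carrier := {p | ∀ (U₀ V₀ : Matrix (Fin r) (Fin n) K) (U V : Fin t → Matrix (Fin c) (Fin n) K)
    (z : Fin t → K), eval (tensorPoint K (lemma16Map K r (fun _ => c) U₀ V₀ U V z).1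
      (lemma16Map K r (fun _ => c) U₀ V₀ U V z).2) p = 0}
  add_mem' ha hb := fun U₀ V₀ U V z => by simp [ha U₀ V₀ U V z, hb U₀ V₀ U V z]
  zero_mem' := fun U₀ V₀ U V z => by simp
  smul_mem' q p hp := fun U₀ V₀ U V z => by simp [hp U₀ V₀ U V z]

/-- The parameters of `g` (Obs. 17: `K^{n×r} × K^{r×n} × (K^{n×c} × K^{c×n})^t` and the `t`
variables `Z`): entries of `U₀, V₀ ∈ K^{r×n}`, of `U_k, V_k ∈ K^{c×n}`, and `z ∈ K^t`.
[cite: BlaserIkenmeyerJindalLysikov2018, Obs. 17] locator: ECCC p.12 -/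
abbrev Lemma16Params (n t c r : ℕ) : Type :=
  ((Fin r × Fin n) ⊕ (Fin r × Fin n)) ⊕ ((Fin t × Fin c × Fin n) ⊕ (Fin t × Fin c × Fin n)) ⊕ Fin t

/-- The coordinates of `g` as polynomials in the parameters (`g` "as a polynomial map").
[cite: BlaserIkenmeyerJindalLysikov2018, Obs. 17] locator: ECCC p.12 -/
def lemma16Poly (n t c r : ℕ) :
    Option (Fin t) × Fin n × Fin n → MvPolynomial (Lemma16Params n t c r) K
  | (none, i, j) =>
      (∑ a : Fin r, X (Sum.inl (Sum.inl (a, i))) * X (Sum.inl (Sum.inr (a, j)))) -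
        ∑ k : Fin t, X (Sum.inr (Sum.inr k)) *
          ∑ a : Fin c, X (Sum.inr (Sum.inl (Sum.inl (k, a, i)))) * X (Sum.inr (Sum.inl (Sum.inr (k, a, j))))
  | (some k, i, j) =>
      ∑ a : Fin c, X (Sum.inr (Sum.inl (Sum.inl (k, a, i)))) * X (Sum.inr (Sum.inl (Sum.inr (k, a, j))))

/-- The parameter point of a tuple `(U₀, V₀, U, V, z)`. [cite: BlaserIkenmeyerJindalLysikov2018, Obs. 17] -/
def lemma16Point {n t c r : ℕ} (U₀ V₀ : Matrix (Fin r) (Fin n) K) (U V : Fin t → Matrix (Fin c) (Fin n) K)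
    (z : Fin t → K) : Lemma16Params n t c r → K
  | Sum.inl (Sum.inl (a, i)) => U₀ a i
  | Sum.inl (Sum.inr (a, j)) => V₀ a j
  | Sum.inr (Sum.inl (Sum.inl (k, a, i))) => U k a i
  | Sum.inr (Sum.inl (Sum.inr (k, a, j))) => V k a j
  | Sum.inr (Sum.inr k) => z k

omit [Field K] in
/-- Every parameter point comes from a tuple. [cite: BlaserIkenmeyerJindalLysikov2018, Obs. 17] -/
theorem exists_lemma16Point_eq {n t c r : ℕ} (θ : Lemma16Params n t c r → K) :
    ∃ (U₀ V₀ : Matrix (Fin r) (Fin n) K) (U V : Fin t → Matrix (Fin c) (Fin n) K) (z : Fin t → K),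
      lemma16Point K U₀ V₀ U V z = θ :=
  ⟨fun a i => θ (Sum.inl (Sum.inl (a, i))), fun a j => θ (Sum.inl (Sum.inr (a, j))),
    fun k a i => θ (Sum.inr (Sum.inl (Sum.inl (k, a, i)))),
    fun k a j => θ (Sum.inr (Sum.inl (Sum.inr (k, a, j)))), fun k => θ (Sum.inr (Sum.inr k)), by
    funext v; rcases v with ((⟨a, i⟩ | ⟨a, j⟩) | ((⟨k, a, i⟩ | ⟨k, a, j⟩) | k)) <;> rfl⟩

/-- `g` evaluated at a parameter point is the tensor `lemma16Map` of the tuple (entrywise).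
[cite: BlaserIkenmeyerJindalLysikov2018, Obs. 17] -/
theorem eval_lemma16Poly {n t c r : ℕ} (U₀ V₀ : Matrix (Fin r) (Fin n) K)
    (U V : Fin t → Matrix (Fin c) (Fin n) K) (z : Fin t → K) (v : Option (Fin t) × Fin n × Fin n) :
    eval (lemma16Point K U₀ V₀ U V z) (lemma16Poly K n t c r v) =
      tensorPoint K (lemma16Map K r (fun _ => c) U₀ V₀ U V z).1
        (lemma16Map K r (fun _ => c) U₀ V₀ U V z).2 v := by
  rcases v with ⟨_ | k, i, j⟩
  · simp [lemma16Poly, lemma16Point, tensorPoint, lemma16Map, Matrix.mul_apply, Matrix.sum_apply,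
      Matrix.sub_apply, Matrix.smul_apply, Finset.mul_sum]
  · simp [lemma16Poly, lemma16Point, tensorPoint, lemma16Map, Matrix.mul_apply]

/-- Over an infinite field, vanishing on the image of `g` means `p ∘ g = 0` as a polynomial.
[cite: BlaserIkenmeyerJindalLysikov2018, Obs. 17] -/
theorem mem_lemma16VanishingIdeal_iff [Infinite K] {n t c r : ℕ}
    (p : MvPolynomial (Option (Fin t) × Fin n × Fin n) K) :
    p ∈ lemma16VanishingIdeal K n t c r ↔ bind₁ (lemma16Poly K n t c r) p = 0 := by
  have hev : ∀ θ : Lemma16Params n t c r → K,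
      eval θ (bind₁ (lemma16Poly K n t c r) p) = eval (fun v => eval θ (lemma16Poly K n t c r v)) p :=
    fun θ => eval₂Hom_bind₁ (RingHom.id K) θ _ p
  constructor
  · intro hp
    apply MvPolynomial.funext
    intro θ
    obtain ⟨U₀, V₀, U, V, z, rfl⟩ := exists_lemma16Point_eq K θ
    rw [map_zero, hev, funext (eval_lemma16Poly K U₀ V₀ U V z)]
    exact hp U₀ V₀ U V z
  · intro hp U₀ V₀ U V z
    have h := congrArg (eval (lemma16Point K U₀ V₀ U V z)) hp
    rwa [hev, map_zero, funext (eval_lemma16Poly K U₀ V₀ U V z)] at h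

-- PROVED (for infinite `K`; over a finite field the statement is false)
/-- **BIJL Obs. 17 (irreducibility).** "The variety `C^{n,t,c}_r` of all such tensors is irreducible:
We can think of `g` constructed in Lemma 16 as a polynomial map from
`K^{n×r} × K^{r×n} × (K^{n×c} × K^{c×n})^t` to `K^{n×n×t}`. The closure of the image of `g` is
`C^{n,t,c}_r`. Therefore, `C^{n,t,c}_r` itself is irreducible." Typed: the vanishing ideal of the
image of `g` is prime; `K` infinite (implicit in print: the argument "image of an affine space
under a polynomial map" needs it). [cite: BlaserIkenmeyerJindalLysikov2018, Obs. 17] locator: ECCC p.12; s2 p0010.txt:L27 -/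
theorem BIJL2018_obs17 [Infinite K] (n t c r : ℕ) : (lemma16VanishingIdeal K n t c r).IsPrime := by
  refine ⟨?_, fun {p q} hpq => ?_⟩
  · rw [Ideal.ne_top_iff_one]
    intro h1
    have := h1 0 0 (fun _ => 0) (fun _ => 0) (fun _ => 0)
    simp at this
  · rw [mem_lemma16VanishingIdeal_iff] at hpq
    rw [mem_lemma16VanishingIdeal_iff, mem_lemma16VanishingIdeal_iff]
    rw [map_mul] at hpq
    exact mul_eq_zero.1 hpq

-- FACT (R1: class hypothesis) — the strengthened barrier for whole equation systems
/-- **BIJL Thm. 4, strengthened form (remark after Obs. 17).** "There are infinite sequences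
`t_n = Θ(n)` and `r_n = Θ(n)` and a constant `c` such that for every set of equations describing
the variety `C^{n,t_n,c}_{r_n}`, at least one equation has superpolynomial circuit complexity,
unless `coNP ⊆ ∃BPP`." Typed (constant-free circuits as in Thm. 4; `K` infinite): unless
`coNP ⊆ ∃·BPP`, there are `t, r : ℕ → ℕ` with `n ≤ a·t n`, `t n ≤ b·n` (and likewise for `r`)
eventually, and `c`, such that for every family `S n` of polynomial sets with zero set exactly
`C^{n,t n,c}_{r n}` (a closed set: "The closure of the image of `g` is `C^{n,t,c}_r`", Obs. 17) and
every exponent `k`, infinitely often some `p ∈ S n` has no constant-free fan-in-two circuit of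
size `≤ n^k + k`.
ERRATUM / SCOPE (val-lit registry A44, lead-np RULING (109); kernel certificates in the sibling
`BIJL18Thm4StrengthenedVacuity.lean`): **VACUOUS AS TYPED.** The parenthetical "a closed set" above is
NOT correct under Def. 9's rank-restricted approximations, over every infinite `K` (algebraically closed
included): for `r < n ≤ c·t` the tensor `(I_n; 0, …, 0)` lies in `Z(I(im g_c))`
(`BIJL2018Thm4S.eval_eq_zero_one_zero`, every `r`) yet has border completion rank `n`
(`BIJL2018Thm4S.borderCompletionRank_one_zero`), so `C^{n,t,c}_r` is the zero set of NO set of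
polynomials (`BIJL2018Thm4S.not_exists_equations_of_lt`) and the `∀ n`-hypothesis on `S` below is
unsatisfiable for every parameter choice `(t, r, c)` with `r n < n ≤ c · t n` at some `n`
(`BIJL2018Thm4S.hypothesis_unsatisfiable`) — in particular for the witnesses of the by-name discharge
at every `n ≥ 1` (`BIJL2018_thm4_strengthened_vacuous`: NO family `S` satisfies it); the statement is
therefore also inhabited vacuously (`BIJL2018Thm4S.BIJL2018_thm4_strengthened_of_degenerate_witnesses`).
The genuine machinery of the printed `∃BPP` argument is `BIJL2018_thm4_strengthened_holds`
(`BIJL18Thm4StrengthenedOfPIT.lean`: bounded-occurrence E3SAT → Max-2-SAT → graded instances →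
`c`-chart tests → two adaptive randomized PIT queries), whose conclusion this typing does not force.
0 consumers — DO NOT CONSUME; a faithful non-vacuous typing of the printed remark (no-spare-slot
tensor family, rank-unrestricted Lemma 14) is not available in print and is not minted (D-0026).
[cite: BlaserIkenmeyerJindalLysikov2018, §3 (after Obs. 17)] locator: ECCC p.12; s2 p0010.txt:L29 -/
def BIJL2018_thm4_strengthened [Infinite K] : Prop :=
  ¬ (coNP ⊆ polyExists BPP) →
    ∃ (t r : ℕ → ℕ) (c a b n₁ : ℕ),
      (∀ n, n₁ ≤ n → n ≤ a * t n ∧ t n ≤ b * n ∧ n ≤ a * r n ∧ r n ≤ b * n) ∧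
      ∀ S : ∀ n : ℕ, Set (MvPolynomial (Option (Fin (t n)) × Fin n × Fin n) K),
        (∀ n, {A | ∀ p ∈ S n, eval (tensorPoint K A.1 A.2) p = 0} = bijlVariety K n (t n) c (r n)) →
        ∀ k n₀ : ℕ, ∃ n : ℕ, n₀ ≤ n ∧ ∃ p ∈ S n,
          ¬ ∃ P : ArithCircuit K (Option (Fin (t n)) × Fin n × Fin n),
            P.IsFanInTwo ∧ P.HasSignConstants ∧ P.Computes p ∧ P.size ≤ n ^ k + k

end NaturalProofs

/-! ### §4: relation to (border) tensor rank -/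

section TensorRank

variable (K : Type u) [Field K]

/-- The `3`-tensor in `K^{(m+1)×n×n}` with slices `A₀` (index `none`) and `A_k` (index `some k`).
[cite: BlaserIkenmeyerJindalLysikov2018, §1.3 ("We can view `(A₀, F₁, …, F_m)` as a tensor")] locator: ECCC p.5 -/
def slicesTensor {ι : Type v} {κ : Type w} (A₀ : Matrix ι ι K) (A : κ → Matrix ι ι K) :
    Option κ → ι → ι → K :=
  fun o i j => (o.elim A₀ A) i j

-- PROVED (`BIJL2018_thm18_holds`, sibling `BIJL18TensorRankSlicesProofs.lean`, val-lit p429999)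
/-- **BIJL Thm. 18 (essentially Derksen [Der14]).** "If `t = (A₀, A₁, …, A_m)` is a tensor such
that the slices `A₀, A₁, …, A_m` are linearly independent and `rk(A₁) = ⋯ = rk(A_m) = 1`, then
`R(t) = CR(t) + m`." (`R` = tensor rank, the tree's `tensorRank`; `m = |κ|`.)
[cite: BlaserIkenmeyerJindalLysikov2018, Thm. 18] locator: ECCC p.12; s2 p0011.txt:L3 -/
def BIJL2018_thm18 : Prop :=
  ∀ (n m : ℕ) (A₀ : Matrix (Fin n) (Fin n) K) (A : Fin m → Matrix (Fin n) (Fin n) K),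
    LinearIndependent K (fun o : Option (Fin m) => o.elim A₀ A) → (∀ k, (A k).rank = 1) →
      tensorRank (slicesTensor K A₀ A) = completionRank A₀ A + m

-- PROVED (`BIJL2018_prop19_holds`, sibling `BIJL18BorderRankSlicesProofs.lean`, val-lit p432699)
/-- **BIJL Prop. 19.** "If `t = (A₀, A₁, …, A_m)` is a tensor such that
`rk(A₁) = ⋯ = rk(A_m) = 1`. Then `\underline{R}(t) ≤ \underline{CR}(t) + m`." (`\underline{R}` =
border tensor rank, the tree's algebraic `algBorderRank` over `K[ε]`.) ("It is not clear whether
[Thm. 18] is true for border rank and border completion rank", ECCC p.12.)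
[cite: BlaserIkenmeyerJindalLysikov2018, Prop. 19] locator: ECCC p.12; s2 p0011.txt:L7 -/
def BIJL2018_prop19 : Prop :=
  ∀ (n m : ℕ) (A₀ : Matrix (Fin n) (Fin n) K) (A : Fin m → Matrix (Fin n) (Fin n) K),
    (∀ k, (A k).rank = 1) → algBorderRank (slicesTensor K A₀ A) ≤ borderCompletionRank A₀ A + m

end TensorRank

/-! ### §5: completion rank and tensor rank are NP-hard to approximate -/

section Approximation

variable (K : Type u) [Field K]

/-- **The gap problem for completion rank with factor `1 + γ`**: yes-instances `(t, r)` with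
`CR(t) ≤ r`, no-instances with `CR(t) > (1 + γ) r` (integer-entry tensors read over `K`).
[cite: BlaserIkenmeyerJindalLysikov2018, Thm. 20] locator: ECCC p.13 -/
def gapCRProblem (γ : ℚ) : PromiseProblem :=
  PromiseProblem.ofEncoding tensorInstEncoding
    {x | WellFormedInst x ∧
      completionRank (slice₀OfList K x.1 x.2.2.1) (slicesOfList K x.1 x.2.1 x.2.2.1) ≤ x.2.2.2}
    {x | WellFormedInst x ∧ (1 + γ) * x.2.2.2 <
      (completionRank (slice₀OfList K x.1 x.2.2.1) (slicesOfList K x.1 x.2.1 x.2.2.1) : ℚ)}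

-- PROVED (`BIJL2018_thm20_holds`, sibling `BIJL18CompletionRankGapProofs.lean`, val-lit p451951 — NOT by the printed route
-- (bounded-occurrence 3-SAT [ACG⁺99, Thm. 8.13] + Lemma 22, cf. the erratum) but by gap-E3SAT (the tree's PCP theorem)
-- → Garey–Johnson–Stockmeyer gadget → Lemma 11's exact `2 × 2` tensor; `γ = (1/8 − ε₀)/26`)
/-- **BIJL Thm. 20.** "Let `K` be any field. There is a constant `γ > 0` such that given a tensor
`T`, it is NP-hard to approximate the completion rank of `T` within a factor of `(1 + γ)`."
Typed as NP-hardness of the gap promise problem `gapCRProblem K γ` for some rational `γ > 0`.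
[cite: BlaserIkenmeyerJindalLysikov2018, Thm. 20] locator: ECCC p.13; s2 p0013.txt:L5 -/
def BIJL2018_thm20 : Prop :=
  ∃ γ : ℚ, 0 < γ ∧ (gapCRProblem K γ).IsNPHard

/-- `ℓ(u) := u` if the variable appears positively in the clause, `1 - u` otherwise.
[cite: BlaserIkenmeyerJindalLysikov2018, §5 (clause gadget)] locator: ECCC p.14 -/
def gl (pos : Bool) (u : K) : K := if pos then u else 1 - u

/-- `s(u) := -u` if the variable appears positively in the clause, `u` otherwise.
[cite: BlaserIkenmeyerJindalLysikov2018, §5 (clause gadget)] locator: ECCC p.14 -/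
def gs (pos : Bool) (u : K) : K := if pos then -u else u

-- PROVED (definition)
/-- **The `9 × 9` clause gadget of §5** for a clause on variables `x, y, z` with polarities
`px, py, pz`, at values `x y z` of the clause variables and `u v w u₁ u₂ v₁ v₂ w₁ w₂` of the local
variables (rows as printed, ECCC p.14):
`[1 x 0 0 0 0 0 0 0; 1 u 0 0 0 0 s(u)−u₁ 0 0; 0 0 1 y 0 0 0 0 0; 0 0 1 v 0 0 0 s(v)−v₁ 0;
 0 0 0 0 1 z 0 0 0; 0 0 0 0 1 w 0 0 s(w)−w₁; 0 u−u₂ 0 0 0 0 1−ℓ(u) 1 0;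
 0 0 0 v−v₂ 0 0 0 1−ℓ(v) 1; 0 0 0 0 0 w−w₂ 0 0 1−ℓ(w)]`.
[cite: BlaserIkenmeyerJindalLysikov2018, §5 (clause gadget before Lemma 21)] locator: ECCC p.14; s2 p0013.txt:L15 -/
def gadget₉ (px py pz : Bool) (x y z u v w u₁ u₂ v₁ v₂ w₁ w₂ : K) : Matrix (Fin 9) (Fin 9) K :=
  !![1, x, 0, 0, 0, 0, 0, 0, 0;
     1, u, 0, 0, 0, 0, gs K px u - u₁, 0, 0;
     0, 0, 1, y, 0, 0, 0, 0, 0;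
     0, 0, 1, v, 0, 0, 0, gs K py v - v₁, 0;
     0, 0, 0, 0, 1, z, 0, 0, 0;
     0, 0, 0, 0, 1, w, 0, 0, gs K pz w - w₁;
     0, u - u₂, 0, 0, 0, 0, 1 - gl K px u, 1, 0;
     0, 0, 0, v - v₂, 0, 0, 0, 1 - gl K py v, 1;
     0, 0, 0, 0, 0, w - w₂, 0, 0, 1 - gl K pz w]

/-- A field value `a` is a Boolean value satisfying the literal of polarity `pos`: `a = 1` and the
literal is positive, or `a = 0` and the literal is negative ("at least one variable is set to a
value from `{0, 1}` and this value satisfies the corresponding literal").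
[cite: BlaserIkenmeyerJindalLysikov2018, Lemma 21] locator: ECCC p.15 -/
def SatisfiesLit (pos : Bool) (a : K) : Prop := (a = 1 ∧ pos = true) ∨ (a = 0 ∧ pos = false)

-- PROVED (`BIJL2018_lemma21_holds`, sibling `BIJL18ClauseGadgetProofs.lean`, val-lit p430994)
/-- **BIJL Lemma 21.** "1. If we set `x, y, z` to values from `{0, 1}` such that the clause is
satisfied, then the local variables in the clause gadget can be set such that the resulting matrix
has rank five. 2. If the variables are set in such a way that the rank of the clause gadget is
five, then `x, y, z` are set such that the clause is satisfied, which means that at least one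
variable is set to a value from `{0, 1}` and this value satisfies the corresponding literal."
[cite: BlaserIkenmeyerJindalLysikov2018, Lemma 21] locator: ECCC p.15; s2 p0013.txt:L23 -/
def BIJL2018_lemma21 : Prop :=
  ∀ px py pz : Bool,
    (∀ x y z : K, (x = 0 ∨ x = 1) → (y = 0 ∨ y = 1) → (z = 0 ∨ z = 1) →
      (SatisfiesLit K px x ∨ SatisfiesLit K py y ∨ SatisfiesLit K pz z) →
      ∃ u v w u₁ u₂ v₁ v₂ w₁ w₂ : K, (gadget₉ K px py pz x y z u v w u₁ u₂ v₁ v₂ w₁ w₂).rank = 5) ∧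
    (∀ x y z u v w u₁ u₂ v₁ v₂ w₁ w₂ : K, (gadget₉ K px py pz x y z u v w u₁ u₂ v₁ v₂ w₁ w₂).rank = 5 →
      SatisfiesLit K px x ∨ SatisfiesLit K py y ∨ SatisfiesLit K pz z)

/-- A 3-clause over the variables `x₀, …, x_{t-1}`: three literals.
[cite: BlaserIkenmeyerJindalLysikov2018, §5] locator: ECCC p.13 -/
abbrev Clause₃ (t : ℕ) : Type := Literal (Fin t) × Literal (Fin t) × Literal (Fin t)

variable {t : ℕ}

/-- The literal in position `a ∈ {0,1,2}` of a 3-clause. [cite: BlaserIkenmeyerJindalLysikov2018, §5] -/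
def Clause₃.lit (c : Clause₃ t) (a : Fin 3) : Literal (Fin t) :=
  if a = 0 then c.1 else if a = 1 then c.2.1 else c.2.2

/-- Number of clauses of the 3-CNF `φ` satisfied by `σ`. [cite: BlaserIkenmeyerJindalLysikov2018, §5] -/
def numSat₃ (φ : List (Clause₃ t)) (σ : Fin t → Bool) : ℕ :=
  φ.countP fun c => c.1.eval σ || c.2.1.eval σ || c.2.2.eval σ

/-- The occurrences of the variable `x` in `φ`: pairs (clause `j`, position `a`).
[cite: BlaserIkenmeyerJindalLysikov2018, §5 (construction of `T_φ`)] locator: ECCC p.16 -/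
abbrev Occ (φ : List (Clause₃ t)) (x : Fin t) : Type :=
  {q : Fin φ.length × Fin 3 // ((φ.get q.1).lit q.2).1 = x}

/-- Row (local index `2a`, printed `1, 3, 5`) of the clause-variable entry in position `a`.
[cite: BlaserIkenmeyerJindalLysikov2018, §5] locator: ECCC p.14 -/
def varRow (a : Fin 3) : Fin 9 := ⟨2 * a.1, by omega⟩

/-- Column (local index `2a+1`, printed `2, 4, 6`) of the clause-variable entry in position `a`;
also the first row/column of the local variable `u, v, w`. [cite: BlaserIkenmeyerJindalLysikov2018, §5] locator: ECCC p.14 -/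
def varCol (a : Fin 3) : Fin 9 := ⟨2 * a.1 + 1, by omega⟩

/-- The clause row/column (local index `6+a`, printed `7, 8, 9`) of position `a`.
[cite: BlaserIkenmeyerJindalLysikov2018, §5] locator: ECCC p.14 -/
def clauseRow (a : Fin 3) : Fin 9 := ⟨6 + a.1, by omega⟩

/-- **Slice index set of `T_φ`**: the formula variables `x ∈ Fin t`; the local variables
`(j, a, w)` of clause `j`, position `a`, with `w = 0, 1, 2` for `u, u₁, u₂` (resp. `v, v₁, v₂`,
`w, w₁, w₂`); and the auxiliary variables `x_{h,ℓ}`, `h ≠ ℓ` occurrences of the same `x`.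
[cite: BlaserIkenmeyerJindalLysikov2018, §5 (construction of `T_φ`)] locator: ECCC p.16 -/
abbrev SliceIdx (φ : List (Clause₃ t)) : Type :=
  Fin t ⊕ (Fin φ.length × Fin 3 × Fin 3) ⊕ (Σ x : Fin t, {p : Occ φ x × Occ φ x // p.1 ≠ p.2})

-- PROVED (definition)
/-- **`T_φ`, constant slice**: block diagonal; block `j` holds the constants of the `9 × 9` gadget
of clause `j` (ones at local `(2a,2a)`, `(2a+1,2a)`, `(6,7)`, `(7,8)`, and the constant of
`1 - ℓ` at `(6+a, 6+a)`: `1` for a positive literal, `0` for a negative one).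
[cite: BlaserIkenmeyerJindalLysikov2018, §5 (construction of `T_φ`)] locator: ECCC pp.14–16 -/
def tphiA₀ (φ : List (Clause₃ t)) : Matrix (Fin φ.length × Fin 9) (Fin φ.length × Fin 9) K :=
  fun p q => if p.1 = q.1 then
    (if (∃ a : Fin 3, (p.2 = varRow a ∨ p.2 = varCol a) ∧ q.2 = varRow a) then 1
     else if (p.2 = 6 ∧ q.2 = 7) ∨ (p.2 = 7 ∧ q.2 = 8) then 1
     else if (∃ a : Fin 3, p.2 = clauseRow a ∧ q.2 = clauseRow a ∧ ((φ.get p.1).lit a).2 = true) then 1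
     else 0)
    else 0

-- PROVED (definition)
/-- **`T_φ`, slices** (all of rank `≤ 1` by design, "All matrices have rank one"):
* formula variable `x`: the rank-one matrix with `1` in all positions `(row(h), col(ℓ))` for
  occurrences `h, ℓ` of `x` ("replace this matrix by a rank one matrix with `1`'s in all positions
  `(i_h, j_ℓ)`");
* local `(j, a, 0)` (`u`/`v`/`w`): on rows `{2a+1, 6+a}` × columns `{2a+1 ↦ 1, 6+a ↦ s}` of block
  `j`, `s = -1` for a positive literal, `+1` otherwise (entries `u`, `s(u)`, `u`, `∓u` of the gadget);
* local `(j, a, 1)` (`u₁`): `-1` at `(2a+1, 6+a)`; local `(j, a, 2)` (`u₂`): `-1` at `(6+a, 2a+1)`;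
* auxiliary `(x, (h, ℓ))`, `h ≠ ℓ`: the unit matrix at `(row(h), col(ℓ))` ("an additional rank-one
  matrix with a `1` in this position and `0`s elsewhere").
[cite: BlaserIkenmeyerJindalLysikov2018, §5 (construction of `T_φ`)] locator: ECCC pp.14–16; s2 p0014.txt:L1 -/
def tphiSlices (φ : List (Clause₃ t)) :
    SliceIdx φ → Matrix (Fin φ.length × Fin 9) (Fin φ.length × Fin 9) K
  | Sum.inl x => fun p q =>
      if (∃ a : Fin 3, ((φ.get p.1).lit a).1 = x ∧ p.2 = varRow a) ∧
          (∃ a : Fin 3, ((φ.get q.1).lit a).1 = x ∧ q.2 = varCol a) then 1 else 0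
  | Sum.inr (Sum.inl (j, a, wh)) => fun p q =>
      if p.1 = j ∧ q.1 = j then
        (if wh = 0 then
          (if (p.2 = varCol a ∨ p.2 = clauseRow a) then
            (if q.2 = varCol a then 1 else if q.2 = clauseRow a then
              (if ((φ.get j).lit a).2 then -1 else 1) else 0) else 0)
         else if wh = 1 then (if p.2 = varCol a ∧ q.2 = clauseRow a then -1 else 0)
         else (if p.2 = clauseRow a ∧ q.2 = varCol a then -1 else 0))
      else 0
  | Sum.inr (Sum.inr ⟨_, ⟨(h, l), _⟩⟩) => fun p q =>
      if p = (h.1.1, varRow h.1.2) ∧ q = (l.1.1, varCol l.1.2) then 1 else 0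

-- REFUTED AS WORDED (part (2): `not_BIJL2018_lemma22`, val-lit p439520); part (1) PROVED
-- (`completionRank_tphi_le_of_satisfiable`); DO NOT CONSUME — the safe reading is
-- `BIJL2018_lemma22_safe` below (PROVED)
/-- **BIJL Lemma 22 (as printed; REFUTED AS WORDED — see the erratum).** "Assume that `φ` is
either satisfiable or any assignment satisfies at most `(1 − ε)` of the clauses for some `ε > 0`.
1. If `φ` is satisfiable, then the completion rank of `T_φ` is at most `5s`. 2. If `φ` is not
satisfiable, then the completion rank of `T_φ` is at least `5s + εs`." (Part 2 typed with its
effective hypothesis: every assignment satisfies at most `(1 − ε)s` clauses.)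
ERRATUM (val-lit, 2026-08-26). This Prop transcribes the print faithfully and is FALSE over every
field: `not_BIJL2018_lemma22` (sibling `BIJL18TPhiCompletionRankProofs.lean`, p439520). For EVERY
3-CNF, `CR(T_φ) ≤ 5s + t` (`completionRank_tphi_le`: the auxiliary variables `x_{h,ℓ}` let every
clause gadget take virtual satisfying values at the cost of one rank-one matrix per formula
variable), so the witness `φ₄ = [x∨x∨x, x∨x∨x, ¬x∨¬x∨¬x, ¬x∨¬x∨¬x]` (`t = 1`, `s = 4`, `ε = 1/2`;
every assignment satisfies exactly `(1 − ε)s = 2` clauses) has `CR(T_φ₄) ≤ 21 < 22 = (5 + ε)s`.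
The printed proof of (2) (ECCC p.16, the column-exchange step "every gadget with only five columns
among them is satisfied") overlooks these couplings. Part (1) is PROVED
(`completionRank_tphi_le_of_satisfiable`). What the printed ingredients do prove is the exact,
gap-free reduction `BIJL2018_lemma22_safe` below (PROVED, `BIJL2018_lemma22_safe_holds`, sibling
`BIJL18TPhiSafeProofs.lean`); and under the bounded-occurrence promise of the source problem of
Thm. 20 (every variable in at most `c` clauses) the gap survives with `ε ↦ ε/c`:
`(5 + ε/c)·s ≤ CR(T_φ)` (`BIJL2018_lemma22_gap`, PROVED, sibling `BIJL18TPhiGapProofs.lean`,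
p444515 — a repair, not a statement of the print), so BIJL's route to Thm. 23 through Thm. 18
survives with the constant divided by `c`; Thm. 23 also rests independently on [SWZ17] per the
paper. DO NOT CONSUME this Prop as a hypothesis (a consumer would be vacuous).
[cite: BlaserIkenmeyerJindalLysikov2018, Lemma 22] locator: ECCC p.16; s2 p0014.txt:L1 -/
def BIJL2018_lemma22 : Prop :=
  ∀ (t : ℕ) (φ : List (Clause₃ t)) (ε : ℚ), 0 < ε →
    ((∃ σ : Fin t → Bool, numSat₃ φ σ = φ.length) →
      completionRank (tphiA₀ K φ) (tphiSlices K φ) ≤ 5 * φ.length) ∧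
    ((∀ σ : Fin t → Bool, (numSat₃ φ σ : ℚ) ≤ (1 - ε) * φ.length) →
      (5 + ε) * φ.length ≤ (completionRank (tphiA₀ K φ) (tphiSlices K φ) : ℚ))

-- PROVED (`BIJL2018_lemma22_safe_holds`, sibling `BIJL18TPhiSafeProofs.lean`)
/-- **BIJL Lemma 22 — SAFE READING (erratum to the printed part (2); val-lit RULING (24)(c)).**
What the printed proof's ingredients establish for the `T_φ` of an ARBITRARY 3-CNF `φ` with `s`
clauses over `t` variables (ECCC p.16: "From every clause gadget, the local columns 1, 3, 5, 8, and
9 are linearly independent … even if we remove the local rows 1, 3, and 5", and Lemma 21 (2): rank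
five forces `u = x`, `v = y`, `w = z` and a literal satisfied by a `{0,1}`-value):
(1) if `φ` is satisfiable then `CR(T_φ) ≤ 5s` [the printed part (1)];
(2′a) `CR(T_φ) ≥ 5s` for every `φ`; (2′b) if `CR(T_φ) = 5s` then `φ` is satisfiable.
Hence `CR(T_φ) ≤ 5s ⇔ CR(T_φ) = 5s ⇔ φ` satisfiable, and unsatisfiable `φ` have `CR(T_φ) ≥ 5s + 1`:
an exact reduction WITHOUT the printed `εs`-gap (false as printed for general 3-CNF,
`not_BIJL2018_lemma22`; with `ε ↦ ε/c` under the bounded-occurrence promise, `c` = the maximal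
number of clauses containing a variable, it holds: `BIJL2018_lemma22_gap`). New name because the text
differs from the print; the printed Prop `BIJL2018_lemma22` above keeps its wording, REFUTED AS WORDED.
[cite: BlaserIkenmeyerJindalLysikov2018, Lemma 22 (1) and proof of Lemma 22 (2), ECCC p.16; Lemma 21 (2)]
locator: ECCC p.16; s2 p0014.txt:L1 -/
def BIJL2018_lemma22_safe : Prop :=
  ∀ (t : ℕ) (φ : List (Clause₃ t)),
    ((∃ σ : Fin t → Bool, numSat₃ φ σ = φ.length) →
      completionRank (tphiA₀ K φ) (tphiSlices K φ) ≤ 5 * φ.length) ∧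
    5 * φ.length ≤ completionRank (tphiA₀ K φ) (tphiSlices K φ) ∧
    (completionRank (tphiA₀ K φ) (tphiSlices K φ) = 5 * φ.length →
      ∃ σ : Fin t → Bool, numSat₃ φ σ = φ.length)

/-- **The gap problem for tensor rank with factor `1 + γ`** (integer tensors `(m+1) × n × n`
read over `K`): yes `R(t) ≤ r`, no `R(t) > (1+γ) r`.
[cite: BlaserIkenmeyerJindalLysikov2018, Thm. 23] locator: ECCC p.17 -/
def gapTensorRankProblem (γ : ℚ) : PromiseProblem :=
  PromiseProblem.ofEncoding tensorInstEncoding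
    {x | WellFormedInst x ∧
      tensorRank (slicesTensor K (slice₀OfList K x.1 x.2.2.1) (slicesOfList K x.1 x.2.1 x.2.2.1)) ≤ x.2.2.2}
    {x | WellFormedInst x ∧ (1 + γ) * x.2.2.2 <
      (tensorRank (slicesTensor K (slice₀OfList K x.1 x.2.2.1) (slicesOfList K x.1 x.2.1 x.2.2.1)) : ℚ)}

-- FACT (R1: NP-hardness)
/-- **BIJL Thm. 23.** "Tensor rank is NP-hard to approximate." (Proof: Lemma 22 and Thm. 18,
`R(T_φ) = CR(T_φ) + k` with `k = Θ(t)` slices; independently Song–Woodruff–Zhong [SWZ17].)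
Typed: for some rational `γ > 0` the gap problem `gapTensorRankProblem K γ` is NP-hard (`K` as in
Thm. 20). [cite: BlaserIkenmeyerJindalLysikov2018, Thm. 23] locator: ECCC p.17; s2 p0014.txt:L15 -/
def BIJL2018_thm23 : Prop :=
  ∃ γ : ℚ, 0 < γ ∧ (gapTensorRankProblem K γ).IsNPHard

end Approximation

/-! ### App. B: the alternative (weak) closure and the separating example -/

section AppendixB

variable {K : Type u} [Field K] {ι : Type v} [Fintype ι] {κ : Type w} [Fintype κ]

-- PROVED (definition)
/-- **App. B, the weaker border completion rank**: "We think of `A₁, …, A_m` being fixed and only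
`A₀` can be approximated. That is, we project `P^{m,n}_r` down to `(A₀, λ₁, …, λ_m)` … Next, we
project `(A₀, λ₁, …, λ_m)` onto the first component … and take the limit there." Rendered
algebraically in the manner of Def. 9: the least `r` with `Ã₀ = A₀ + O(ε)` and
`λ ∈ K(ε)^m` such that `rk(Ã₀ + Σ λ_k A_k) ≤ r`.
[cite: BlaserIkenmeyerJindalLysikov2018, App. B] locator: ECCC p.26; s2 p0019.txt:L3 -/
def weakBorderCompletionRank (A₀ : Matrix ι ι K) (A : κ → Matrix ι ι K) : ℕ :=
  sInf {r | ∃ (B₀ : Matrix ι ι (RatFunc K)) (c : κ → RatFunc K),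
    IsMatrixApproxOf A₀ B₀ ∧ (pencilEval B₀ (fun k => (A k).map RatFunc.C) c).rank ≤ r}

/-- **App. B example**: `A₀ = I₃`, `A₁ = E₃₁` (the variable `x`), `A₂ = E₃₂` (the variable `y`),
i.e. the matrix `[[1,0,0],[0,1,0],[x,y,1]]`. [cite: BlaserIkenmeyerJindalLysikov2018, App. B]
locator: ECCC p.26 -/
def appBSlices (K : Type u) [Field K] : Fin 2 → Matrix (Fin 3) (Fin 3) K :=
  fun k => Matrix.of fun i j => if i = 2 ∧ j.1 = k.1 then 1 else 0

-- PROVED (`BIJL2018_appB_example_holds`, sibling `BIJL18MatrixCompletionAppBProofs.lean`, val-lit p422603)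
/-- **App. B (the two closures differ).** For `A₀ = I₃`, `A₁ = E₃₁`, `A₂ = E₃₂`: "No matter how we
substitute the variables, the upper-left `2 × 2`-minor of any close-enough approximation to this
matrix will be nonzero. (… we can however bring down the rank to `2` by substituting `y ↦ 1/ε`.)
On the other hand, if we work with approximations to `A₁` and `A₂`, we can bring down the border
completion rank down to one … `\underline{CR}(A₀, A₁, A₂) = 1`. This example shows that the two
definitions actually differ." [cite: BlaserIkenmeyerJindalLysikov2018, App. B] locator: ECCC pp.26–27 -/
def BIJL2018_appB_example (K : Type u) [Field K] : Prop :=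
  weakBorderCompletionRank (1 : Matrix (Fin 3) (Fin 3) K) (appBSlices K) = 2 ∧
    borderCompletionRank (1 : Matrix (Fin 3) (Fin 3) K) (appBSlices K) = 1

end AppendixB

end Literature.Barriers.ValiantsHypothesis

end
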